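import Summits.AtomisticToContinuum.Crystallization.Theorems.FreeSplittingCertificatesStrictSplittingRuleHardyProfile
import Summits.AtomisticToContinuum.Crystallization.Theorems.FreeSplittingCertificatesStrictSplittingRuleHcpShellMoments

/-!
# `StrictSplittingRule` (stmt-AtomisticToContinuum-12560): the quadratic profile is a Hardy supersolution on the hcp exterior

Route `FreeSplittingCertificates`, crux r3 `StrictSplittingRule`, line `registered` (unit b2b-freesplit-B, gen 6).
Fourth brick of the far lemma of the H12⋆ architecture (HOME CERT.md §14 (3)); assembles
`…StrictSplittingRuleHardyProfile.lean` (moment form of the supersolution margin of `φ = ‖y‖²` against the bond weights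
`c_{x,x+s} = c₆(‖y_x‖⁻⁶ + ‖y_{x+s}‖⁻⁶)` of an `r⁻⁶` import family) with `…StrictSplittingRuleHcpShellMoments.lean` (closed-form
moments of the relaxed hcp first shell).  For a site at relative position `z = y_x − y_P ≠ 0` whose twelve bond vectors are
the root-shell vectors `y_s = hcpSite a h s`, `s ∈ hcpStarIdx` (even-layer sites; at odd-layer sites the bond vectors are
`−y_s` and the same statement applies to `−z`, since `‖z − y_s‖ = ‖−z + y_s‖`), the normalised Laplacian of the profile is
`(L_c φ)(x)/c₆ = Σ_s (‖z‖⁻⁶ + ‖z + y_s‖⁻⁶)(‖z‖² − ‖z + y_s‖²)`, and this file proves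

* `hcpShell_delta_cube_sum` — the third `δ`-moment in closed form,
  `Σ_s δ_s³ = 8 T₃(z) + 12(3a⁴ρ² + b²(a²ρ² + 6h²z₂²)) + 6a⁶ + 6b⁶` with `δ_s = 2⟪z, y_s⟫ + ‖y_s‖²`, `ρ² = z₀² + z₁²`,
  `b² = a²/3 + h²`, `T₃ = Σ_s ⟪z, y_s⟫³`;
* `hcpHardyWeight_margin_fine` — the margin in closed form:
  `(L_c φ)(x)/c₆ ≥ ‖z‖⁻⁶ · [ −16a² − 12h² + 3(16a²ρ² + 24h²z₂² + 6a⁴ + 6b⁴)/‖z‖² − 6(Σ_s δ_s³)/‖z‖⁴ ]`;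
* `hcpHardyWeight_margin` — the RADIAL lower bound: with `r = ‖z‖`,
  `(L_c φ)(x)/c₆ ≥ r⁻⁶ · κ(a,h,r)`,
  `κ(a,h,r) = 3·min(16a², 24h²) − 16a² − 12h² − (72·max(3a⁴ + a²b², 6b²h²) − 18a⁴ − 18b⁴)/r² − 8√3·a³/r − 36(a⁶ + b⁶)/r⁴`.
  For ideal hcp (`h² = 2a²/3`, `b = a`) this is `24a² − 252a⁴/r² − 8√3 a³/r − 72a⁶/r⁴`: positive from `r ≈ 3.6a` on
  (`κ(4a) ≈ 4.5a²`, `κ(6a) ≈ 14.6a²`, `κ → 24a²`), against the exact float margin `≥ 23a²` at every site `r ≥ 2a`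
  (HOME/code/partB/gen6-farlemma); the inner shells `2a ≤ r < 4a` are left to a finite rational check.

With `…GroundStateHardy.sum_mul_sq_le_dirichlet_of_supersolution` this is the discrete weighted Hardy inequality
`Σ_x c₆ κ(a,h,‖y_x‖) ‖y_x‖⁻⁸ f_x² ≤ Σ_x c₆ ‖y_x‖⁻⁶ Σ_{s ∈ shell(x)} (f_{x+s} − f_x)²` for `f` supported where `κ > 0` — the
step of the far lemma that charges the bare `r⁻⁸` radial deficit of far bonds (`stub_farPairLowerBound`) to the receipts of an
`r⁻⁶` import family.  Structural bookkeeping ([folklore]); VALUE = a kernel-checked brick — NOT summit progress.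
-/

noncomputable section

namespace Summit.AtomisticToContinuum.Crystallization.Theorems.StrictSplittingRuleBirth

open scoped BigOperators
open Literature.MathematicalPhysics.StatisticalMechanics
open Summit.AtomisticToContinuum.Crystallization.Theorems.PalmUnimodularRigidity.LayeredLawsSelectHcp

/-- The in-layer labels have first moment zero, and so do the off-layer ones. [folklore] -/
theorem hcpShell_sum_inner_split (a h : ℝ) (z : EuclideanSpace ℝ (Fin 3)) :
    inner ℝ z (hcpSite a h (0, 1, 0)) + inner ℝ z (hcpSite a h (0, -1, 0)) + inner ℝ z (hcpSite a h (0, 0, 1)) +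
        inner ℝ z (hcpSite a h (0, 0, -1)) + inner ℝ z (hcpSite a h (0, 1, -1)) + inner ℝ z (hcpSite a h (0, -1, 1)) = 0 ∧
      inner ℝ z (hcpSite a h (1, 0, 0)) + inner ℝ z (hcpSite a h (1, -1, 0)) + inner ℝ z (hcpSite a h (1, 0, -1)) +
        inner ℝ z (hcpSite a h (-1, 0, 0)) + inner ℝ z (hcpSite a h (-1, -1, 0)) + inner ℝ z (hcpSite a h (-1, 0, -1)) =
        0 := by
  obtain ⟨e1, e2, e3, e4, e5, e6, e7, e8, e9, e10, e11, e12⟩ := hcpShell_inner a h z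
  rw [e1, e2, e3, e4, e5, e6, e7, e8, e9, e10, e11, e12]
  constructor <;> ring

/-- `Σ_s ‖y_s‖⁴ ⟪z, y_s⟫ = 0`. [folklore] -/
theorem hcpShell_sum_norm_pow_four_mul_inner (a h : ℝ) (z : EuclideanSpace ℝ (Fin 3)) :
    ∑ s ∈ hcpStarIdx, ‖hcpSite a h s‖ ^ 4 * inner ℝ z (hcpSite a h s) = 0 := by
  have hn : ∀ s ∈ hcpStarIdx, ‖hcpSite a h s‖ ^ 4 * inner ℝ z (hcpSite a h s) =
      (if s.1 = 0 then a ^ 2 else a ^ 2 / 3 + h ^ 2) ^ 2 * inner ℝ z (hcpSite a h s) := fun s hs => by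
    rw [← hcpShell_norm_sq a h hs]; ring
  obtain ⟨hin, hoff⟩ := hcpShell_sum_inner_split a h z
  rw [Finset.sum_congr rfl hn, hcpShell_sum_expand]
  norm_num
  linear_combination (a ^ 2) ^ 2 * hin + (a ^ 2 / 3 + h ^ 2) ^ 2 * hoff

/-- `Σ_s ‖y_s‖² ⟪z, y_s⟫² = 3a⁴ρ² + (a²/3 + h²)(a²ρ² + 6h²z₂²)`, `ρ² = z₀² + z₁²`. [folklore] -/
theorem hcpShell_sum_norm_sq_mul_inner_sq (a h : ℝ) (z : EuclideanSpace ℝ (Fin 3)) :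
    ∑ s ∈ hcpStarIdx, ‖hcpSite a h s‖ ^ 2 * inner ℝ z (hcpSite a h s) ^ 2 =
      3 * a ^ 4 * (z 0 ^ 2 + z 1 ^ 2) + (a ^ 2 / 3 + h ^ 2) * (a ^ 2 * (z 0 ^ 2 + z 1 ^ 2) + 6 * h ^ 2 * z 2 ^ 2) := by
  have hn : ∀ s ∈ hcpStarIdx, ‖hcpSite a h s‖ ^ 2 * inner ℝ z (hcpSite a h s) ^ 2 =
      (if s.1 = 0 then a ^ 2 else a ^ 2 / 3 + h ^ 2) * inner ℝ z (hcpSite a h s) ^ 2 := fun s hs => by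
    rw [hcpShell_norm_sq a h hs]
  have hin := hcpShell_second_moment_inLayer a h z
  have hoff := hcpShell_second_moment_offLayer a h z
  rw [Finset.sum_congr rfl hn, hcpShell_sum_expand]
  norm_num
  linear_combination (a ^ 2) * hin + (a ^ 2 / 3 + h ^ 2) * hoff

/-- `Σ_s ‖y_s‖⁶ = 6a⁶ + 6(a²/3 + h²)³`. [folklore] -/
theorem hcpShell_sum_norm_pow_six (a h : ℝ) :
    ∑ s ∈ hcpStarIdx, ‖hcpSite a h s‖ ^ 6 = 6 * a ^ 6 + 6 * (a ^ 2 / 3 + h ^ 2) ^ 3 := by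
  have hn : ∀ s ∈ hcpStarIdx, ‖hcpSite a h s‖ ^ 6 = (if s.1 = 0 then a ^ 2 else a ^ 2 / 3 + h ^ 2) ^ 3 :=
    fun s hs => by rw [← hcpShell_norm_sq a h hs]; ring
  rw [Finset.sum_congr rfl hn, hcpShell_sum_expand]
  norm_num
  ring

/-- **Third `δ`-moment in closed form**: with `δ_s = 2⟪z, y_s⟫ + ‖y_s‖²`,
`Σ_s δ_s³ = 8 Σ_s⟪z, y_s⟫³ + 12(3a⁴ρ² + b²(a²ρ² + 6h²z₂²)) + 6a⁶ + 6b⁶` (`b² = a²/3 + h²`). [folklore] -/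
theorem hcpShell_delta_cube_sum (a h : ℝ) (z : EuclideanSpace ℝ (Fin 3)) :
    ∑ s ∈ hcpStarIdx, (2 * inner ℝ z (hcpSite a h s) + ‖hcpSite a h s‖ ^ 2) ^ 3 =
      8 * ∑ s ∈ hcpStarIdx, inner ℝ z (hcpSite a h s) ^ 3 +
        12 * (3 * a ^ 4 * (z 0 ^ 2 + z 1 ^ 2) +
          (a ^ 2 / 3 + h ^ 2) * (a ^ 2 * (z 0 ^ 2 + z 1 ^ 2) + 6 * h ^ 2 * z 2 ^ 2)) +
        (6 * a ^ 6 + 6 * (a ^ 2 / 3 + h ^ 2) ^ 3) := by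
  have hx : ∀ s ∈ hcpStarIdx, (2 * inner ℝ z (hcpSite a h s) + ‖hcpSite a h s‖ ^ 2) ^ 3 =
      8 * inner ℝ z (hcpSite a h s) ^ 3 + 12 * (‖hcpSite a h s‖ ^ 2 * inner ℝ z (hcpSite a h s) ^ 2) +
        6 * (‖hcpSite a h s‖ ^ 4 * inner ℝ z (hcpSite a h s)) + ‖hcpSite a h s‖ ^ 6 := fun s _ => by ring
  rw [Finset.sum_congr rfl hx, Finset.sum_add_distrib, Finset.sum_add_distrib, Finset.sum_add_distrib,
    ← Finset.mul_sum, ← Finset.mul_sum, ← Finset.mul_sum, hcpShell_sum_norm_sq_mul_inner_sq,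
    hcpShell_sum_norm_pow_four_mul_inner, hcpShell_sum_norm_pow_six]
  ring

/-- **The margin in closed form.**  For `z ≠ 0` with `z + y_s ≠ 0` for all shell labels `s`:
`Σ_s (‖z‖⁻⁶ + ‖z + y_s‖⁻⁶)(‖z‖² − ‖z + y_s‖²) ≥ ‖z‖⁻⁶ [ −2(8a² + 6h²) + 3 Σδ²/‖z‖² − 6 Σδ³/‖z‖⁴ ]` with the second and
third `δ`-moments of `…HcpShellMoments` / `hcpShell_delta_cube_sum`. [folklore] -/
theorem hcpHardyWeight_margin_fine (a h : ℝ) (z : EuclideanSpace ℝ (Fin 3)) (hz : z ≠ 0)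
    (hzs : ∀ s ∈ hcpStarIdx, z + hcpSite a h s ≠ 0) :
    ((‖z‖ ^ 2) ^ 3)⁻¹ * (-2 * (8 * a ^ 2 + 6 * h ^ 2) +
        3 / ‖z‖ ^ 2 * (16 * a ^ 2 * (z 0 ^ 2 + z 1 ^ 2) + 24 * h ^ 2 * z 2 ^ 2 + 6 * a ^ 4 + 6 * (a ^ 2 / 3 + h ^ 2) ^ 2) -
        6 / (‖z‖ ^ 2) ^ 2 * (8 * ∑ s ∈ hcpStarIdx, inner ℝ z (hcpSite a h s) ^ 3 +
          12 * (3 * a ^ 4 * (z 0 ^ 2 + z 1 ^ 2) + (a ^ 2 / 3 + h ^ 2) * (a ^ 2 * (z 0 ^ 2 + z 1 ^ 2) + 6 * h ^ 2 * z 2 ^ 2)) +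
          (6 * a ^ 6 + 6 * (a ^ 2 / 3 + h ^ 2) ^ 3))) ≤
      ∑ s ∈ hcpStarIdx, (((‖z‖ ^ 2) ^ 3)⁻¹ + ((‖z + hcpSite a h s‖ ^ 2) ^ 3)⁻¹) * (‖z‖ ^ 2 - ‖z + hcpSite a h s‖ ^ 2) := by
  have hr : 0 < ‖z‖ ^ 2 := by positivity
  have hσ : ∀ s ∈ hcpStarIdx, 0 < ‖z + hcpSite a h s‖ ^ 2 := fun s hs => by
    have := hzs s hs; positivity
  have key := hardyProfile_sum_ge hcpStarIdx hr (fun s => ‖z + hcpSite a h s‖ ^ 2) hσ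
  have hδ : ∀ s ∈ hcpStarIdx, ‖z + hcpSite a h s‖ ^ 2 - ‖z‖ ^ 2 = 2 * inner ℝ z (hcpSite a h s) + ‖hcpSite a h s‖ ^ 2 :=
    fun s _ => hardyProfile_delta_eq z (hcpSite a h s)
  have h1 : ∑ s ∈ hcpStarIdx, (‖z + hcpSite a h s‖ ^ 2 - ‖z‖ ^ 2) = 8 * a ^ 2 + 6 * h ^ 2 := by
    rw [Finset.sum_congr rfl hδ]; exact hcpShell_delta_sum a h z
  have h2 : ∑ s ∈ hcpStarIdx, (‖z + hcpSite a h s‖ ^ 2 - ‖z‖ ^ 2) ^ 2 =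
      16 * a ^ 2 * (z 0 ^ 2 + z 1 ^ 2) + 24 * h ^ 2 * z 2 ^ 2 + 6 * a ^ 4 + 6 * (a ^ 2 / 3 + h ^ 2) ^ 2 := by
    rw [Finset.sum_congr rfl fun s hs => by rw [hδ s hs]]; exact hcpShell_delta_sq_sum a h z
  have h3 : ∑ s ∈ hcpStarIdx, (‖z + hcpSite a h s‖ ^ 2 - ‖z‖ ^ 2) ^ 3 =
      8 * ∑ s ∈ hcpStarIdx, inner ℝ z (hcpSite a h s) ^ 3 +
        12 * (3 * a ^ 4 * (z 0 ^ 2 + z 1 ^ 2) +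
          (a ^ 2 / 3 + h ^ 2) * (a ^ 2 * (z 0 ^ 2 + z 1 ^ 2) + 6 * h ^ 2 * z 2 ^ 2)) +
        (6 * a ^ 6 + 6 * (a ^ 2 / 3 + h ^ 2) ^ 3) := by
    rw [Finset.sum_congr rfl fun s hs => by rw [hδ s hs]]; exact hcpShell_delta_cube_sum a h z
  rw [h1, h2, h3] at key
  exact key

/-- **The quadratic profile is a supersolution on the hcp exterior, with an explicit radial margin.**  For `a, h > 0`,
`z ≠ 0` with `z + y_s ≠ 0` for all shell labels, and `r = ‖z‖`:
`Σ_s (‖z‖⁻⁶ + ‖z + y_s‖⁻⁶)(‖z‖² − ‖z + y_s‖²) ≥ r⁻⁶ κ(a,h,r)`,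
`κ = 3·min(16a², 24h²) − 16a² − 12h² − (72·max(3a⁴ + a²b², 6b²h²) − 18a⁴ − 18b⁴)/r² − 8√3 a³/r − 36(a⁶ + b⁶)/r⁴`,
`b² = a²/3 + h²` (ideal hcp: `24a² − 252a⁴/r² − 8√3a³/r − 72a⁶/r⁴`, positive from `r ≈ 3.6a` on). [folklore] -/
theorem hcpHardyWeight_margin {a h : ℝ} (ha : 0 < a) (hh : 0 < h) (z : EuclideanSpace ℝ (Fin 3)) (hz : z ≠ 0)
    (hzs : ∀ s ∈ hcpStarIdx, z + hcpSite a h s ≠ 0) :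
    ((‖z‖ ^ 2) ^ 3)⁻¹ *
        (3 * min (16 * a ^ 2) (24 * h ^ 2) - 16 * a ^ 2 - 12 * h ^ 2 -
          (72 * max (3 * a ^ 4 + a ^ 2 * (a ^ 2 / 3 + h ^ 2)) (6 * (a ^ 2 / 3 + h ^ 2) * h ^ 2) - 18 * a ^ 4 -
              18 * (a ^ 2 / 3 + h ^ 2) ^ 2) / ‖z‖ ^ 2 -
          8 * √3 * a ^ 3 / ‖z‖ - 36 * (a ^ 6 + (a ^ 2 / 3 + h ^ 2) ^ 3) / ‖z‖ ^ 4) ≤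
      ∑ s ∈ hcpStarIdx, (((‖z‖ ^ 2) ^ 3)⁻¹ + ((‖z + hcpSite a h s‖ ^ 2) ^ 3)⁻¹) * (‖z‖ ^ 2 - ‖z + hcpSite a h s‖ ^ 2) := by
  refine le_trans ?_ (hcpHardyWeight_margin_fine a h z hz hzs)
  have hr : 0 < ‖z‖ := norm_pos_iff.2 hz
  refine mul_le_mul_of_nonneg_left ?_ (by positivity)
  have hsplit : ‖z‖ ^ 2 = (z 0 ^ 2 + z 1 ^ 2) + z 2 ^ 2 := norm_sq_eq_three z
  have hP : 0 ≤ z 0 ^ 2 + z 1 ^ 2 := by positivity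
  have hW : 0 ≤ z 2 ^ 2 := by positivity
  have hb0 : 0 < a ^ 2 / 3 + h ^ 2 := by positivity
  -- (1) second moment from below
  have hmin : min (16 * a ^ 2) (24 * h ^ 2) * ‖z‖ ^ 2 ≤ 16 * a ^ 2 * (z 0 ^ 2 + z 1 ^ 2) + 24 * h ^ 2 * z 2 ^ 2 := by
    have h1 := min_le_left (16 * a ^ 2) (24 * h ^ 2)
    have h2 := min_le_right (16 * a ^ 2) (24 * h ^ 2)
    rw [hsplit]
    nlinarith [mul_nonneg (sub_nonneg.2 h1) hP, mul_nonneg (sub_nonneg.2 h2) hW]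
  -- (2) mixed cubic moment from above
  have hmax : 3 * a ^ 4 * (z 0 ^ 2 + z 1 ^ 2) + (a ^ 2 / 3 + h ^ 2) * (a ^ 2 * (z 0 ^ 2 + z 1 ^ 2) + 6 * h ^ 2 * z 2 ^ 2) ≤
      max (3 * a ^ 4 + a ^ 2 * (a ^ 2 / 3 + h ^ 2)) (6 * (a ^ 2 / 3 + h ^ 2) * h ^ 2) * ‖z‖ ^ 2 := by
    have h1 := le_max_left (3 * a ^ 4 + a ^ 2 * (a ^ 2 / 3 + h ^ 2)) (6 * (a ^ 2 / 3 + h ^ 2) * h ^ 2)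
    have h2 := le_max_right (3 * a ^ 4 + a ^ 2 * (a ^ 2 / 3 + h ^ 2)) (6 * (a ^ 2 / 3 + h ^ 2) * h ^ 2)
    rw [hsplit]
    nlinarith [mul_nonneg (sub_nonneg.2 h1) hP, mul_nonneg (sub_nonneg.2 h2) hW]
  -- (3) third moment from above: T ≤ (√3/6) a³ ‖z‖³
  have hT2 : (∑ s ∈ hcpStarIdx, inner ℝ z (hcpSite a h s) ^ 3) ^ 2 ≤ a ^ 6 / 12 * (z 0 ^ 2 + z 1 ^ 2) ^ 3 :=
    hcpShell_third_moment_sq_le a h z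
  have hPr : z 0 ^ 2 + z 1 ^ 2 ≤ ‖z‖ ^ 2 := by rw [hsplit]; linarith
  have hT3 : (∑ s ∈ hcpStarIdx, inner ℝ z (hcpSite a h s) ^ 3) ^ 2 ≤ (√3 / 6 * a ^ 3 * ‖z‖ ^ 3) ^ 2 := by
    have h3 : (√3 : ℝ) ^ 2 = 3 := Real.sq_sqrt (by norm_num)
    have e : (√3 / 6 * a ^ 3 * ‖z‖ ^ 3) ^ 2 = a ^ 6 / 12 * (‖z‖ ^ 2) ^ 3 := by
      linear_combination (a ^ 6 * (‖z‖ ^ 2) ^ 3 / 36) * h3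
    rw [e]
    exact hT2.trans (mul_le_mul_of_nonneg_left (pow_le_pow_left₀ hP hPr 3) (by positivity))
  have hTle : ∑ s ∈ hcpStarIdx, inner ℝ z (hcpSite a h s) ^ 3 ≤ √3 / 6 * a ^ 3 * ‖z‖ ^ 3 :=
    (abs_le_of_sq_le_sq' hT3 (by positivity)).2
  -- assemble: rewrite the radial bracket in the shape of the fine bracket, then compare monotonically
  have hr4 : (‖z‖ ^ 2) ^ 2 = ‖z‖ ^ 4 := by ring
  rw [hr4]
  have goal_eq :
      3 * min (16 * a ^ 2) (24 * h ^ 2) - 16 * a ^ 2 - 12 * h ^ 2 -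
          (72 * max (3 * a ^ 4 + a ^ 2 * (a ^ 2 / 3 + h ^ 2)) (6 * (a ^ 2 / 3 + h ^ 2) * h ^ 2) - 18 * a ^ 4 -
              18 * (a ^ 2 / 3 + h ^ 2) ^ 2) / ‖z‖ ^ 2 -
          8 * √3 * a ^ 3 / ‖z‖ - 36 * (a ^ 6 + (a ^ 2 / 3 + h ^ 2) ^ 3) / ‖z‖ ^ 4 =
        -2 * (8 * a ^ 2 + 6 * h ^ 2) +
          3 / ‖z‖ ^ 2 * (min (16 * a ^ 2) (24 * h ^ 2) * ‖z‖ ^ 2 + 6 * a ^ 4 + 6 * (a ^ 2 / 3 + h ^ 2) ^ 2) -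
          6 / ‖z‖ ^ 4 * (8 * (√3 / 6 * a ^ 3 * ‖z‖ ^ 3) +
            12 * (max (3 * a ^ 4 + a ^ 2 * (a ^ 2 / 3 + h ^ 2)) (6 * (a ^ 2 / 3 + h ^ 2) * h ^ 2) * ‖z‖ ^ 2) +
            (6 * a ^ 6 + 6 * (a ^ 2 / 3 + h ^ 2) ^ 3)) := by
    field_simp
    ring
  rw [goal_eq]
  have hA : 3 / ‖z‖ ^ 2 * (min (16 * a ^ 2) (24 * h ^ 2) * ‖z‖ ^ 2 + 6 * a ^ 4 + 6 * (a ^ 2 / 3 + h ^ 2) ^ 2) ≤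
      3 / ‖z‖ ^ 2 * (16 * a ^ 2 * (z 0 ^ 2 + z 1 ^ 2) + 24 * h ^ 2 * z 2 ^ 2 + 6 * a ^ 4 + 6 * (a ^ 2 / 3 + h ^ 2) ^ 2) :=
    mul_le_mul_of_nonneg_left (by linarith) (by positivity)
  have hB : 6 / ‖z‖ ^ 4 * (8 * ∑ s ∈ hcpStarIdx, inner ℝ z (hcpSite a h s) ^ 3 +
          12 * (3 * a ^ 4 * (z 0 ^ 2 + z 1 ^ 2) + (a ^ 2 / 3 + h ^ 2) * (a ^ 2 * (z 0 ^ 2 + z 1 ^ 2) + 6 * h ^ 2 * z 2 ^ 2)) +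
          (6 * a ^ 6 + 6 * (a ^ 2 / 3 + h ^ 2) ^ 3)) ≤
      6 / ‖z‖ ^ 4 * (8 * (√3 / 6 * a ^ 3 * ‖z‖ ^ 3) +
        12 * (max (3 * a ^ 4 + a ^ 2 * (a ^ 2 / 3 + h ^ 2)) (6 * (a ^ 2 / 3 + h ^ 2) * h ^ 2) * ‖z‖ ^ 2) +
        (6 * a ^ 6 + 6 * (a ^ 2 / 3 + h ^ 2) ^ 3)) :=
    mul_le_mul_of_nonneg_left (by linarith) (by positivity)
  linarith

end Summit.AtomisticToContinuum.Crystallization.Theorems.StrictSplittingRuleBirth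

end
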